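import Summits.KontsevichZagierPeriods.Zeta5Search.Barrier.ConeGammaS7CritSwap

/-!
# ζ(5) search — BARRIER: the CUBIC resolvent of BZ's §5 critical system (≤ 3 critical points in the open box)

HONEST FRAMING (cell `pub-zeta5`): systematic search; no irrationality claim unless kernel-certified. MODEL objects
under Brown–Zudilin's (28)+(30) accounting ([BZ22] = arXiv:2210.03391; (28) observed, not proved); this file is real
polynomial algebra about BZ's §5 critical system `F₁ = F₂ = 0` (tree: `ConeGammaRates.F1R/F2R/IsCritical/critVals`);
nothing here is a statement about the size of any critical value, the cone's supremum (C2 = `BarrierC2`, OPEN),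
S-E (CONJECTURED) or `ζ(5)`. No number or sentence of record moves. Records in print UNMOVED. Prover P2 g23
(self-selected Lean-only item «BZ's cubic (20) in the kernel», file 1).

BZ (§5, (20)) eliminate to a CUBIC in `λ` «with coefficients polynomial in `a`», not printed. In the tree the
elimination is `ConeGammaS7CritSwapCore`: in shifted coordinates `X = x − s₆`, `Y = y − s₆` one has
`F₂ = (X+Y)·Q − (s₆−s₀)·P` and, at the forced value of `X·Q`, `F₁·Q⁴ = (s₆−s₀)(Y+s₆)Q²·D(Y)` with an explicit
quartic `D`. THIS FILE: **`D(Y) = (Y − s₀)·C(Y)` identically** (`resolvent_eq_mul_cubic`; the root `Y = s₀` is BZ's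
trivial solution `(0, p₃)` of (19), never critical), where
`C(Y) = −E·(s₁+s₂+s₇−Y)²(s₀−Y) + B·(s₁+s₂+s₇−Y)·P + (Y−s₀+σ₁)·P²`
(`E = Π_{j∈{3,4,5,6}}(Y+s_j)`, `P = (Y−s₁)(Y−s₂)(Y−s₇)`, `B` the cubic of `swapPhi_eq`, `σ₁ = s₃+s₄+s₅+s₆`) is a
CUBIC in `Y` (`cubic_newton`, `exists_cubic_coeffs` — the monomial form has 41/149/149/41 terms and is only ever
used existentially) with **`C(s₁) = −Π_{j∈{3,4,5,6}}(s₁+s_j)·(s₂+s₇)²·(s₀−s₁)`** (`cubic_at_s1`; `< 0` on the open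
box, `cubic_at_s1_neg`, so `C ≢ 0` there). Consequences (the cubic `C`, `P`, `Q` enter as equational hypotheses
`hC`/`hP`/`hQ`, à la `ConeGammaS7CritSwapCore`):
* `isCritical_aOfS_root` — `s₆ ≠ s₀`: a critical point `(x, y)` of `aOfS s` has `C(y−s₆) = 0`, `P, Q ≠ 0` there and
  `x = s₆ − (y−s₆) + (s₆−s₀)·P/Q` (so `x` is determined by `y`);
* `isCritical_aOfS_of_root` — conversely a root `Y` of `C` with `Q(Y) ≠ 0` at which the twelve arguments of the
  growth functional are non-zero IS a critical point `(s₆ − Y + (s₆−s₀)P/Q, Y + s₆)`;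
* `critVals_aOfS_eq_image` — `critVals (aOfS s)` is the image of the admissible roots under the value map;
* `cubicFun_roots_finite` — a cubic function that is not identically zero has a finite zero set of `ncard ≤ 3`
  (`Cubic.card_roots_le`);
* **`critVals_aOfS_finite_of_openBox`, `critVals_finite_of_openBox`** — at EVERY direction of the open box the set
  of critical values is finite with at most three elements (so `Regular` = «all three roots of the cubic real, none
  lost on the loss loci of `ConeGammaS7CritWitness*`, values pairwise distinct» is the generic maximum).
-/

noncomputable section

open Set

namespace Summit.KontsevichZagierPeriods.Zeta5Search.Barrier.ConeGamma

/-! ### The quartic resolvent factors: `D = (Y − s₀)·C` -/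

/-- **`D(Y) = (Y − s₀)·C(Y)`**: the quartic resolvent of `ConeGammaS7CritSwapCore.swap_D_eq_zero` (`c = s₆`,
`d = s₅`) is divisible by `Y − s₀`, with the cubic cofactor `C` displayed on the right. -/
theorem resolvent_eq_mul_cubic (Y s0 s1 s2 s3 s4 s5 s6 s7 : ℝ) :
    (Y + s3) * (Y + s4) * (Y + s6) * (Y + s5) * ((s1 + s2 + s7 - Y) * (s0 - Y)) ^ 2
        - (2 * Y ^ 3 - 2 * (s0 - (s3 + s4 + s6 + s5)) * Y ^ 2 - (s0 * (s3 + s4 + s6 + s5)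
            - (s3 * s4 + s3 * s6 + s3 * s5 + s4 * s6 + s4 * s5 + s6 * s5)) * Y
            - (s0 * (s3 * s4 + s3 * s6 + s3 * s5 + s4 * s6 + s4 * s5 + s6 * s5)
              - (s3 * s4 * s6 + s3 * s4 * s5 + s3 * s6 * s5 + s4 * s6 * s5)))
          * ((s1 + s2 + s7 - Y) * (s0 - Y)) * ((Y - s1) * (Y - s2) * (Y - s7))
        + (Y - s0) * (Y - s0 + (s3 + s4 + s6 + s5)) * ((Y - s1) * (Y - s2) * (Y - s7)) ^ 2
      = (Y - s0) *
        (-((Y + s3) * (Y + s4) * (Y + s6) * (Y + s5)) * (s1 + s2 + s7 - Y) ^ 2 * (s0 - Y)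
          + (2 * Y ^ 3 - 2 * (s0 - (s3 + s4 + s6 + s5)) * Y ^ 2 - (s0 * (s3 + s4 + s6 + s5)
              - (s3 * s4 + s3 * s6 + s3 * s5 + s4 * s6 + s4 * s5 + s6 * s5)) * Y
              - (s0 * (s3 * s4 + s3 * s6 + s3 * s5 + s4 * s6 + s4 * s5 + s6 * s5)
                - (s3 * s4 * s6 + s3 * s4 * s5 + s3 * s6 * s5 + s4 * s6 * s5)))
            * (s1 + s2 + s7 - Y) * ((Y - s1) * (Y - s2) * (Y - s7))
          + (Y - s0 + (s3 + s4 + s6 + s5)) * ((Y - s1) * (Y - s2) * (Y - s7)) ^ 2) := by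
  ring

/-! ### The cubic `C` as an equational hypothesis; it is a cubic; its value at `Y = s₁` -/

/-- **Newton form**: `C` is a polynomial of degree `≤ 3` in `Y` — its values are interpolated by the cubic through
`Y = 0, 1, 2, 3` (a polynomial identity in `(s, Y)`, so `ring` proves it; the formal degree of the display is 7). -/
theorem cubic_newton {s : Fin 8 → ℝ} {C : ℝ → ℝ}
    (hC : ∀ Y, C Y = -((Y + s 3) * (Y + s 4) * (Y + s 6) * (Y + s 5)) * (s 1 + s 2 + s 7 - Y) ^ 2 * (s 0 - Y)
      + (2 * Y ^ 3 - 2 * (s 0 - (s 3 + s 4 + s 6 + s 5)) * Y ^ 2 - (s 0 * (s 3 + s 4 + s 6 + s 5)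
          - (s 3 * s 4 + s 3 * s 6 + s 3 * s 5 + s 4 * s 6 + s 4 * s 5 + s 6 * s 5)) * Y
          - (s 0 * (s 3 * s 4 + s 3 * s 6 + s 3 * s 5 + s 4 * s 6 + s 4 * s 5 + s 6 * s 5)
            - (s 3 * s 4 * s 6 + s 3 * s 4 * s 5 + s 3 * s 6 * s 5 + s 4 * s 6 * s 5)))
        * (s 1 + s 2 + s 7 - Y) * ((Y - s 1) * (Y - s 2) * (Y - s 7))
      + (Y - s 0 + (s 3 + s 4 + s 6 + s 5)) * ((Y - s 1) * (Y - s 2) * (Y - s 7)) ^ 2) (Y : ℝ) :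
    C Y = C 0 + (C 1 - C 0) * Y + (C 2 - 2 * C 1 + C 0) * (Y * (Y - 1) / 2)
      + (C 3 - 3 * C 2 + 3 * C 1 - C 0) * (Y * (Y - 1) * (Y - 2) / 6) := by
  simp only [hC]
  ring

/-- **`C` is a cubic**: there are coefficients (polynomial in `s`; only their existence is used) with
`C(Y) = aY³ + bY² + cY + d`. -/
theorem exists_cubic_coeffs {s : Fin 8 → ℝ} {C : ℝ → ℝ}
    (hC : ∀ Y, C Y = -((Y + s 3) * (Y + s 4) * (Y + s 6) * (Y + s 5)) * (s 1 + s 2 + s 7 - Y) ^ 2 * (s 0 - Y)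
      + (2 * Y ^ 3 - 2 * (s 0 - (s 3 + s 4 + s 6 + s 5)) * Y ^ 2 - (s 0 * (s 3 + s 4 + s 6 + s 5)
          - (s 3 * s 4 + s 3 * s 6 + s 3 * s 5 + s 4 * s 6 + s 4 * s 5 + s 6 * s 5)) * Y
          - (s 0 * (s 3 * s 4 + s 3 * s 6 + s 3 * s 5 + s 4 * s 6 + s 4 * s 5 + s 6 * s 5)
            - (s 3 * s 4 * s 6 + s 3 * s 4 * s 5 + s 3 * s 6 * s 5 + s 4 * s 6 * s 5)))
        * (s 1 + s 2 + s 7 - Y) * ((Y - s 1) * (Y - s 2) * (Y - s 7))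
      + (Y - s 0 + (s 3 + s 4 + s 6 + s 5)) * ((Y - s 1) * (Y - s 2) * (Y - s 7)) ^ 2) :
    ∃ a b c d : ℝ, ∀ Y, C Y = a * Y ^ 3 + b * Y ^ 2 + c * Y + d := by
  refine ⟨(C 3 - 3 * C 2 + 3 * C 1 - C 0) / 6, (C 2 - 2 * C 1 + C 0) / 2 - (C 3 - 3 * C 2 + 3 * C 1 - C 0) / 2,
    (C 1 - C 0) - (C 2 - 2 * C 1 + C 0) / 2 + (C 3 - 3 * C 2 + 3 * C 1 - C 0) / 3, C 0, fun Y => ?_⟩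
  rw [cubic_newton hC Y]
  ring

/-- **`C(s₁) = −(s₁+s₃)(s₁+s₄)(s₁+s₆)(s₁+s₅)·(s₂+s₇)²·(s₀−s₁)`** (`P(s₁) = 0`). -/
theorem cubic_at_s1 {s : Fin 8 → ℝ} {C : ℝ → ℝ}
    (hC : ∀ Y, C Y = -((Y + s 3) * (Y + s 4) * (Y + s 6) * (Y + s 5)) * (s 1 + s 2 + s 7 - Y) ^ 2 * (s 0 - Y)
      + (2 * Y ^ 3 - 2 * (s 0 - (s 3 + s 4 + s 6 + s 5)) * Y ^ 2 - (s 0 * (s 3 + s 4 + s 6 + s 5)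
          - (s 3 * s 4 + s 3 * s 6 + s 3 * s 5 + s 4 * s 6 + s 4 * s 5 + s 6 * s 5)) * Y
          - (s 0 * (s 3 * s 4 + s 3 * s 6 + s 3 * s 5 + s 4 * s 6 + s 4 * s 5 + s 6 * s 5)
            - (s 3 * s 4 * s 6 + s 3 * s 4 * s 5 + s 3 * s 6 * s 5 + s 4 * s 6 * s 5)))
        * (s 1 + s 2 + s 7 - Y) * ((Y - s 1) * (Y - s 2) * (Y - s 7))
      + (Y - s 0 + (s 3 + s 4 + s 6 + s 5)) * ((Y - s 1) * (Y - s 2) * (Y - s 7)) ^ 2) :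
    C (s 1) = -((s 1 + s 3) * (s 1 + s 4) * (s 1 + s 6) * (s 1 + s 5)) * (s 2 + s 7) ^ 2 * (s 0 - s 1) := by
  rw [hC]
  ring

/-- **On the open box `C(s₁) < 0`**, in particular `C ≢ 0` (uses `0 < s₁ < s₀`, `0 < s₃, s₄, s₅, s₆`, `0 < s₂, s₇`). -/
theorem cubic_at_s1_neg {s : Fin 8 → ℝ} {C : ℝ → ℝ}
    (hC : ∀ Y, C Y = -((Y + s 3) * (Y + s 4) * (Y + s 6) * (Y + s 5)) * (s 1 + s 2 + s 7 - Y) ^ 2 * (s 0 - Y)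
      + (2 * Y ^ 3 - 2 * (s 0 - (s 3 + s 4 + s 6 + s 5)) * Y ^ 2 - (s 0 * (s 3 + s 4 + s 6 + s 5)
          - (s 3 * s 4 + s 3 * s 6 + s 3 * s 5 + s 4 * s 6 + s 4 * s 5 + s 6 * s 5)) * Y
          - (s 0 * (s 3 * s 4 + s 3 * s 6 + s 3 * s 5 + s 4 * s 6 + s 4 * s 5 + s 6 * s 5)
            - (s 3 * s 4 * s 6 + s 3 * s 4 * s 5 + s 3 * s 6 * s 5 + s 4 * s 6 * s 5)))
        * (s 1 + s 2 + s 7 - Y) * ((Y - s 1) * (Y - s 2) * (Y - s 7))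
      + (Y - s 0 + (s 3 + s 4 + s 6 + s 5)) * ((Y - s 1) * (Y - s 2) * (Y - s 7)) ^ 2)
    (hbox : ∀ j : Fin 7, 0 < s j.succ ∧ s j.succ < s 0) : C (s 1) < 0 := by
  rw [cubic_at_s1 hC]
  have h1 := hbox 0; have h2 := hbox 1; have h3 := hbox 2; have h4 := hbox 3; have h5 := hbox 4
  have h6 := hbox 5; have h7 := hbox 6
  simp only [Fin.succ_zero_eq_one] at h1
  change 0 < s 2 ∧ s 2 < s 0 at h2; change 0 < s 3 ∧ s 3 < s 0 at h3; change 0 < s 4 ∧ s 4 < s 0 at h4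
  change 0 < s 5 ∧ s 5 < s 0 at h5; change 0 < s 6 ∧ s 6 < s 0 at h6; change 0 < s 7 ∧ s 7 < s 0 at h7
  have hE : 0 < (s 1 + s 3) * (s 1 + s 4) * (s 1 + s 6) * (s 1 + s 5) := by
    have := h1.1; have := h3.1; have := h4.1; have := h5.1; have := h6.1; positivity
  have hM : 0 < (s 2 + s 7) ^ 2 := by have := h2.1; have := h7.1; positivity
  have h01 : 0 < s 0 - s 1 := by linarith [h1.2]
  have := mul_pos (mul_pos hE hM) h01
  linarith

/-! ### Critical points ↔ admissible roots of the cubic -/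

/-- **A critical point sits over a root of the cubic.** For `s₆ ≠ s₀`: if `(x, y)` is a critical point of `aOfS s`
then, with `Y = y − s₆`: `C(Y) = 0`, `P(Y) ≠ 0`, `Q(Y) ≠ 0`, and `x = s₆ − Y + (s₆−s₀)·P(Y)/Q(Y)`. -/
theorem isCritical_aOfS_root {s : Fin 8 → ℝ} {P Q C : ℝ → ℝ}
    (hP : ∀ Y, P Y = (Y - s 1) * (Y - s 2) * (Y - s 7))
    (hQ : ∀ Y, Q Y = (Y + s 6) * ((s 1 + s 2 + s 7 - Y) * (s 0 - Y)) - P Y)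
    (hC : ∀ Y, C Y = -((Y + s 3) * (Y + s 4) * (Y + s 6) * (Y + s 5)) * (s 1 + s 2 + s 7 - Y) ^ 2 * (s 0 - Y)
      + (2 * Y ^ 3 - 2 * (s 0 - (s 3 + s 4 + s 6 + s 5)) * Y ^ 2 - (s 0 * (s 3 + s 4 + s 6 + s 5)
          - (s 3 * s 4 + s 3 * s 6 + s 3 * s 5 + s 4 * s 6 + s 4 * s 5 + s 6 * s 5)) * Y
          - (s 0 * (s 3 * s 4 + s 3 * s 6 + s 3 * s 5 + s 4 * s 6 + s 4 * s 5 + s 6 * s 5)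
            - (s 3 * s 4 * s 6 + s 3 * s 4 * s 5 + s 3 * s 6 * s 5 + s 4 * s 6 * s 5)))
        * (s 1 + s 2 + s 7 - Y) * ((Y - s 1) * (Y - s 2) * (Y - s 7))
      + (Y - s 0 + (s 3 + s 4 + s 6 + s 5)) * ((Y - s 1) * (Y - s 2) * (Y - s 7)) ^ 2)
    (h06 : s 6 ≠ s 0) {x y : ℝ} (hc : IsCritical (aOfS s) x y) :
    C (y - s 6) = 0 ∧ P (y - s 6) ≠ 0 ∧ Q (y - s 6) ≠ 0
      ∧ x = s 6 - (y - s 6) + (s 6 - s 0) * P (y - s 6) / Q (y - s 6) := by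
  obtain ⟨hF1, hF2, hv⟩ := hc
  rw [F1R_aOfS] at hF1
  rw [F2R_aOfS] at hF2
  rw [critFactors_aOfS] at hv
  have hv3 : x + y - (s 0 + s 6) ≠ 0 := by simpa using hv 3
  have hv7 : y - (s 6 + s 7) ≠ 0 := by simpa using hv 7
  have hv8 : y - (s 2 + s 6) ≠ 0 := by simpa using hv 8
  have hv9 : y - (s 1 + s 6) ≠ 0 := by simpa using hv 9
  have hv11 : s 0 + s 6 - y ≠ 0 := by simpa using hv 11
  have hy0 : y ≠ 0 := by
    intro h0
    apply mul_ne_zero (mul_ne_zero (mul_ne_zero hv3 hv7) hv8) hv9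
    calc (x + y - (s 0 + s 6)) * (y - (s 6 + s 7)) * (y - (s 2 + s 6)) * (y - (s 1 + s 6))
        = (x + y - 2 * s 6) * (s 1 + s 2 + s 6 + s 7 - y) * (s 0 + s 6 - y) * y := by linear_combination -hF2
      _ = 0 := by rw [h0, mul_zero]
  -- shifted coordinates `X = x − s₆`, `Y = y − s₆`
  have hF1c : (x - s 6 + s 6) * (s 0 - (x - s 6)) * (s 3 + s 4 + s 5 - (x - s 6)) * (x - s 6 + (y - s 6))
      - (x - s 6 - s 3) * (x - s 6 - s 4) * (x - s 6 - s 5) * (x - s 6 + (y - s 6) + s 6 - s 0) = 0 := by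
    linear_combination hF1
  have hF2c : (y - s 6 + s 6) * (s 1 + s 2 + s 7 - (y - s 6)) * (s 0 - (y - s 6)) * (x - s 6 + (y - s 6))
      - (x - s 6 + (y - s 6) + s 6 - s 0) * (y - s 6 - s 1) * (y - s 6 - s 2) * (y - s 6 - s 7) = 0 := by
    linear_combination hF2
  have hPc : (y - s 6 - s 1) * (y - s 6 - s 2) * (y - s 6 - s 7) ≠ 0 := by
    have e : (y - s 6 - s 1) * (y - s 6 - s 2) * (y - s 6 - s 7)
        = (y - (s 1 + s 6)) * (y - (s 2 + s 6)) * (y - (s 6 + s 7)) := by ring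
    rw [e]; exact mul_ne_zero (mul_ne_zero hv9 hv8) hv7
  have hy6 : y - s 6 + s 6 ≠ 0 := by rw [sub_add_cancel]; exact hy0
  have hD := swap_D_eq_zero hF1c hF2c h06 hPc hy6
  rw [resolvent_eq_mul_cubic] at hD
  have hYs0 : y - s 6 - s 0 ≠ 0 := fun h => hv11 (by linear_combination -h)
  have hPY : P (y - s 6) ≠ 0 := by rw [hP]; exact hPc
  have hCY : C (y - s 6) = 0 := by
    rcases mul_eq_zero.mp hD with h | h
    · exact absurd h hYs0
    · rw [hC]; linear_combination h
  -- `F₂ = (X+Y)·Q − (s₆−s₀)·P`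
  have hF2Q : (x - s 6 + (y - s 6)) * Q (y - s 6) - (s 6 - s 0) * P (y - s 6) = 0 := by
    rw [hQ, hP]; linear_combination hF2
  have hQY : Q (y - s 6) ≠ 0 := by
    intro hQ0
    rw [hQ0, mul_zero, zero_sub, neg_eq_zero] at hF2Q
    rcases mul_eq_zero.mp hF2Q with h | h
    · exact h06 (by linear_combination h)
    · exact hPY h
  refine ⟨hCY, hPY, hQY, ?_⟩
  field_simp
  linear_combination hF2Q

/-- **Conversely, an admissible root is a critical point.** For `s₆ ≠ s₀`: if `C(Y) = 0`, `Q(Y) ≠ 0`, and the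
twelve arguments of the growth functional are non-zero at `(x, y) = (s₆ − Y + (s₆−s₀)P(Y)/Q(Y), Y + s₆)`, then
`(x, y)` is a critical point of `aOfS s` (`F₂ = 0` by construction of `x`; `F₁·Q⁴ = (s₆−s₀)(Y+s₆)Q²(Y−s₀)·C(Y) = 0`). -/
theorem isCritical_aOfS_of_root {s : Fin 8 → ℝ} {P Q C : ℝ → ℝ}
    (hP : ∀ Y, P Y = (Y - s 1) * (Y - s 2) * (Y - s 7))
    (hQ : ∀ Y, Q Y = (Y + s 6) * ((s 1 + s 2 + s 7 - Y) * (s 0 - Y)) - P Y)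
    (hC : ∀ Y, C Y = -((Y + s 3) * (Y + s 4) * (Y + s 6) * (Y + s 5)) * (s 1 + s 2 + s 7 - Y) ^ 2 * (s 0 - Y)
      + (2 * Y ^ 3 - 2 * (s 0 - (s 3 + s 4 + s 6 + s 5)) * Y ^ 2 - (s 0 * (s 3 + s 4 + s 6 + s 5)
          - (s 3 * s 4 + s 3 * s 6 + s 3 * s 5 + s 4 * s 6 + s 4 * s 5 + s 6 * s 5)) * Y
          - (s 0 * (s 3 * s 4 + s 3 * s 6 + s 3 * s 5 + s 4 * s 6 + s 4 * s 5 + s 6 * s 5)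
            - (s 3 * s 4 * s 6 + s 3 * s 4 * s 5 + s 3 * s 6 * s 5 + s 4 * s 6 * s 5)))
        * (s 1 + s 2 + s 7 - Y) * ((Y - s 1) * (Y - s 2) * (Y - s 7))
      + (Y - s 0 + (s 3 + s 4 + s 6 + s 5)) * ((Y - s 1) * (Y - s 2) * (Y - s 7)) ^ 2)
    {Y : ℝ} (hCY : C Y = 0) (hQY : Q Y ≠ 0)
    (hv : ∀ k, critFactors (pR (aOfS s)) (qR (aOfS s)) (s 6 - Y + (s 6 - s 0) * P Y / Q Y) (Y + s 6) k ≠ 0) :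
    IsCritical (aOfS s) (s 6 - Y + (s 6 - s 0) * P Y / Q Y) (Y + s 6) := by
  refine ⟨?_, ?_, hv⟩
  · -- `F₁ = 0` via the resolvent identity
    rw [F1R_aOfS]
    have hXQ : (s 6 - Y + (s 6 - s 0) * P Y / Q Y - s 6) * Q Y = (s 6 - s 0) * P Y - Y * Q Y := by
      field_simp
      ring
    have h1 := swapF1_mul_pow (s 6 - Y + (s 6 - s 0) * P Y / Q Y - s 6) Y (Q Y) ((s 6 - s 0) * P Y - Y * Q Y)
      (s 0) (s 3) (s 4) (s 6) (s 5) hXQ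
    have h2 := swapPhi_eq Y ((s 1 + s 2 + s 7 - Y) * (s 0 - Y)) (P Y) (Q Y) (s 0) (s 3) (s 4) (s 6) (s 5) (hQ Y)
    rw [h2] at h1
    -- the quartic on the right is `(Y − s₀)·C(Y) = 0`
    have hD : (Y + s 3) * (Y + s 4) * (Y + s 6) * (Y + s 5) * ((s 1 + s 2 + s 7 - Y) * (s 0 - Y)) ^ 2
        - (2 * Y ^ 3 - 2 * (s 0 - (s 3 + s 4 + s 6 + s 5)) * Y ^ 2 - (s 0 * (s 3 + s 4 + s 6 + s 5)
            - (s 3 * s 4 + s 3 * s 6 + s 3 * s 5 + s 4 * s 6 + s 4 * s 5 + s 6 * s 5)) * Y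
            - (s 0 * (s 3 * s 4 + s 3 * s 6 + s 3 * s 5 + s 4 * s 6 + s 4 * s 5 + s 6 * s 5)
              - (s 3 * s 4 * s 6 + s 3 * s 4 * s 5 + s 3 * s 6 * s 5 + s 4 * s 6 * s 5)))
          * ((s 1 + s 2 + s 7 - Y) * (s 0 - Y)) * (P Y)
        + (Y - s 0) * (Y - s 0 + (s 3 + s 4 + s 6 + s 5)) * (P Y) ^ 2 = 0 := by
      have hc0 : C Y = 0 := hCY
      rw [hC] at hc0
      rw [hP, resolvent_eq_mul_cubic, hc0, mul_zero]
    rw [hD] at h1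
    simp only [mul_zero] at h1
    -- `F₁ · Q⁴ = 0` with `Q ≠ 0`
    have hF1X : (s 6 - Y + (s 6 - s 0) * P Y / Q Y - s 6 + s 6) * (s 0 - (s 6 - Y + (s 6 - s 0) * P Y / Q Y - s 6))
          * (s 3 + s 4 + s 5 - (s 6 - Y + (s 6 - s 0) * P Y / Q Y - s 6))
          * (s 6 - Y + (s 6 - s 0) * P Y / Q Y - s 6 + Y)
        - (s 6 - Y + (s 6 - s 0) * P Y / Q Y - s 6 - s 3) * (s 6 - Y + (s 6 - s 0) * P Y / Q Y - s 6 - s 4)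
          * (s 6 - Y + (s 6 - s 0) * P Y / Q Y - s 6 - s 5)
          * (s 6 - Y + (s 6 - s 0) * P Y / Q Y - s 6 + Y + s 6 - s 0) = 0 := by
      rcases mul_eq_zero.mp h1 with h | h
      · exact h
      · exact absurd (pow_eq_zero_iff (by norm_num) |>.mp h) hQY
    linear_combination hF1X
  · -- `F₂ = 0` by construction
    rw [F2R_aOfS]
    have e := swapF2_eq (s 6 - Y + (s 6 - s 0) * P Y / Q Y - s 6) Y ((s 1 + s 2 + s 7 - Y) * (s 0 - Y)) (P Y)
      (Q Y) (s 0) (s 1) (s 2) (s 7) (s 6) rfl (hP Y) (hQ Y)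
    have hzero : (s 6 - Y + (s 6 - s 0) * P Y / Q Y - s 6 + Y) * Q Y - (s 6 - s 0) * P Y = 0 := by
      field_simp
      ring
    rw [hzero] at e
    linear_combination e

/-- **The critical values are the values over the admissible roots.** For `s₆ ≠ s₀`, `critVals (aOfS s)` is the
image, under the value map `Y ↦ log|λ|(s₆ − Y + (s₆−s₀)P/Q, Y + s₆)`, of the set of roots `Y` of the cubic with
`Q(Y) ≠ 0` at which the twelve arguments are non-zero. -/
theorem critVals_aOfS_eq_image {s : Fin 8 → ℝ} {P Q C : ℝ → ℝ}
    (hP : ∀ Y, P Y = (Y - s 1) * (Y - s 2) * (Y - s 7))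
    (hQ : ∀ Y, Q Y = (Y + s 6) * ((s 1 + s 2 + s 7 - Y) * (s 0 - Y)) - P Y)
    (hC : ∀ Y, C Y = -((Y + s 3) * (Y + s 4) * (Y + s 6) * (Y + s 5)) * (s 1 + s 2 + s 7 - Y) ^ 2 * (s 0 - Y)
      + (2 * Y ^ 3 - 2 * (s 0 - (s 3 + s 4 + s 6 + s 5)) * Y ^ 2 - (s 0 * (s 3 + s 4 + s 6 + s 5)
          - (s 3 * s 4 + s 3 * s 6 + s 3 * s 5 + s 4 * s 6 + s 4 * s 5 + s 6 * s 5)) * Y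
          - (s 0 * (s 3 * s 4 + s 3 * s 6 + s 3 * s 5 + s 4 * s 6 + s 4 * s 5 + s 6 * s 5)
            - (s 3 * s 4 * s 6 + s 3 * s 4 * s 5 + s 3 * s 6 * s 5 + s 4 * s 6 * s 5)))
        * (s 1 + s 2 + s 7 - Y) * ((Y - s 1) * (Y - s 2) * (Y - s 7))
      + (Y - s 0 + (s 3 + s 4 + s 6 + s 5)) * ((Y - s 1) * (Y - s 2) * (Y - s 7)) ^ 2)
    (h06 : s 6 ≠ s 0) :
    critVals (aOfS s)
      = (fun Y => growthLogR (pR (aOfS s)) (qR (aOfS s)) (s 6 - Y + (s 6 - s 0) * P Y / Q Y) (Y + s 6)) ''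
        {Y | C Y = 0 ∧ Q Y ≠ 0 ∧
          ∀ k, critFactors (pR (aOfS s)) (qR (aOfS s)) (s 6 - Y + (s 6 - s 0) * P Y / Q Y) (Y + s 6) k ≠ 0} := by
  ext v
  simp only [critVals, Set.mem_setOf_eq, Set.mem_image]
  constructor
  · rintro ⟨x, y, hc, rfl⟩
    obtain ⟨hCY, _, hQY, hx⟩ := isCritical_aOfS_root hP hQ hC h06 hc
    refine ⟨y - s 6, ⟨hCY, hQY, ?_⟩, ?_⟩
    · rw [← hx, sub_add_cancel]; exact hc.2.2
    · simp only [← hx, sub_add_cancel]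
  · rintro ⟨Y, ⟨hCY, hQY, hv⟩, rfl⟩
    exact ⟨_, _, isCritical_aOfS_of_root hP hQ hC hCY hQY hv, rfl⟩

/-! ### Counting: a cubic function has at most three zeros -/

/-- **A cubic function that is not identically zero has a finite zero set with at most three elements**
(`Cubic.card_roots_le`). -/
theorem cubicFun_roots_finite {C : ℝ → ℝ} {a b c d : ℝ} (hC : ∀ Y, C Y = a * Y ^ 3 + b * Y ^ 2 + c * Y + d)
    {Y₀ : ℝ} (h0 : C Y₀ ≠ 0) : {Y | C Y = 0}.Finite ∧ {Y | C Y = 0}.ncard ≤ 3 := by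
  classical
  have hP : (⟨a, b, c, d⟩ : Cubic ℝ).toPoly ≠ 0 := by
    intro h
    have h' := (Cubic.toPoly_eq_zero_iff _).mp h
    have ha : a = 0 := congrArg Cubic.a h'
    have hb : b = 0 := congrArg Cubic.b h'
    have hc : c = 0 := congrArg Cubic.c h'
    have hd : d = 0 := congrArg Cubic.d h'
    apply h0
    rw [hC, ha, hb, hc, hd]; ring
  have hset : {Y | C Y = 0} = ↑((⟨a, b, c, d⟩ : Cubic ℝ).roots.toFinset) := by
    ext Y
    simp only [Set.mem_setOf_eq, Finset.mem_coe, Multiset.mem_toFinset, Cubic.mem_roots_iff hP, hC]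
  rw [hset]
  exact ⟨Finset.finite_toSet _, by rw [Set.ncard_coe_finset]; exact Cubic.card_roots_le⟩

/-- **At most three critical values at every direction `aOfS s` of the open box**: `critVals (aOfS s)` is finite
with `ncard ≤ 3`. -/
theorem critVals_aOfS_finite_of_openBox {s : Fin 8 → ℝ} (hbox : ∀ j : Fin 7, 0 < s j.succ ∧ s j.succ < s 0) :
    (critVals (aOfS s)).Finite ∧ (critVals (aOfS s)).ncard ≤ 3 := by
  -- the cubic, `P`, `Q` as functions
  have h6 := hbox 5
  change 0 < s 6 ∧ s 6 < s 0 at h6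
  have h06 : s 6 ≠ s 0 := h6.2.ne
  have himg := critVals_aOfS_eq_image (s := s) (P := fun Y => (Y - s 1) * (Y - s 2) * (Y - s 7))
    (Q := fun Y => (Y + s 6) * ((s 1 + s 2 + s 7 - Y) * (s 0 - Y)) - (Y - s 1) * (Y - s 2) * (Y - s 7))
    (C := fun Y => -((Y + s 3) * (Y + s 4) * (Y + s 6) * (Y + s 5)) * (s 1 + s 2 + s 7 - Y) ^ 2 * (s 0 - Y)
      + (2 * Y ^ 3 - 2 * (s 0 - (s 3 + s 4 + s 6 + s 5)) * Y ^ 2 - (s 0 * (s 3 + s 4 + s 6 + s 5)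
          - (s 3 * s 4 + s 3 * s 6 + s 3 * s 5 + s 4 * s 6 + s 4 * s 5 + s 6 * s 5)) * Y
          - (s 0 * (s 3 * s 4 + s 3 * s 6 + s 3 * s 5 + s 4 * s 6 + s 4 * s 5 + s 6 * s 5)
            - (s 3 * s 4 * s 6 + s 3 * s 4 * s 5 + s 3 * s 6 * s 5 + s 4 * s 6 * s 5)))
        * (s 1 + s 2 + s 7 - Y) * ((Y - s 1) * (Y - s 2) * (Y - s 7))
      + (Y - s 0 + (s 3 + s 4 + s 6 + s 5)) * ((Y - s 1) * (Y - s 2) * (Y - s 7)) ^ 2)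
    (fun _ => rfl) (fun _ => rfl) (fun _ => rfl) h06
  obtain ⟨a, b, c, d, habcd⟩ := exists_cubic_coeffs (s := s)
    (C := fun Y => -((Y + s 3) * (Y + s 4) * (Y + s 6) * (Y + s 5)) * (s 1 + s 2 + s 7 - Y) ^ 2 * (s 0 - Y)
      + (2 * Y ^ 3 - 2 * (s 0 - (s 3 + s 4 + s 6 + s 5)) * Y ^ 2 - (s 0 * (s 3 + s 4 + s 6 + s 5)
          - (s 3 * s 4 + s 3 * s 6 + s 3 * s 5 + s 4 * s 6 + s 4 * s 5 + s 6 * s 5)) * Y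
          - (s 0 * (s 3 * s 4 + s 3 * s 6 + s 3 * s 5 + s 4 * s 6 + s 4 * s 5 + s 6 * s 5)
            - (s 3 * s 4 * s 6 + s 3 * s 4 * s 5 + s 3 * s 6 * s 5 + s 4 * s 6 * s 5)))
        * (s 1 + s 2 + s 7 - Y) * ((Y - s 1) * (Y - s 2) * (Y - s 7))
      + (Y - s 0 + (s 3 + s 4 + s 6 + s 5)) * ((Y - s 1) * (Y - s 2) * (Y - s 7)) ^ 2) (fun _ => rfl)
  have hneg := cubic_at_s1_neg (s := s)
    (C := fun Y => -((Y + s 3) * (Y + s 4) * (Y + s 6) * (Y + s 5)) * (s 1 + s 2 + s 7 - Y) ^ 2 * (s 0 - Y)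
      + (2 * Y ^ 3 - 2 * (s 0 - (s 3 + s 4 + s 6 + s 5)) * Y ^ 2 - (s 0 * (s 3 + s 4 + s 6 + s 5)
          - (s 3 * s 4 + s 3 * s 6 + s 3 * s 5 + s 4 * s 6 + s 4 * s 5 + s 6 * s 5)) * Y
          - (s 0 * (s 3 * s 4 + s 3 * s 6 + s 3 * s 5 + s 4 * s 6 + s 4 * s 5 + s 6 * s 5)
            - (s 3 * s 4 * s 6 + s 3 * s 4 * s 5 + s 3 * s 6 * s 5 + s 4 * s 6 * s 5)))
        * (s 1 + s 2 + s 7 - Y) * ((Y - s 1) * (Y - s 2) * (Y - s 7))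
      + (Y - s 0 + (s 3 + s 4 + s 6 + s 5)) * ((Y - s 1) * (Y - s 2) * (Y - s 7)) ^ 2) (fun _ => rfl) hbox
  obtain ⟨hfin, hcard⟩ := cubicFun_roots_finite habcd hneg.ne
  have hsub : {Y | (fun Y => -((Y + s 3) * (Y + s 4) * (Y + s 6) * (Y + s 5)) * (s 1 + s 2 + s 7 - Y) ^ 2 * (s 0 - Y)
      + (2 * Y ^ 3 - 2 * (s 0 - (s 3 + s 4 + s 6 + s 5)) * Y ^ 2 - (s 0 * (s 3 + s 4 + s 6 + s 5)
          - (s 3 * s 4 + s 3 * s 6 + s 3 * s 5 + s 4 * s 6 + s 4 * s 5 + s 6 * s 5)) * Y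
          - (s 0 * (s 3 * s 4 + s 3 * s 6 + s 3 * s 5 + s 4 * s 6 + s 4 * s 5 + s 6 * s 5)
            - (s 3 * s 4 * s 6 + s 3 * s 4 * s 5 + s 3 * s 6 * s 5 + s 4 * s 6 * s 5)))
        * (s 1 + s 2 + s 7 - Y) * ((Y - s 1) * (Y - s 2) * (Y - s 7))
      + (Y - s 0 + (s 3 + s 4 + s 6 + s 5)) * ((Y - s 1) * (Y - s 2) * (Y - s 7)) ^ 2) Y = 0 ∧
        (fun Y => (Y + s 6) * ((s 1 + s 2 + s 7 - Y) * (s 0 - Y)) - (Y - s 1) * (Y - s 2) * (Y - s 7)) Y ≠ 0 ∧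
        ∀ k, critFactors (pR (aOfS s)) (qR (aOfS s))
          (s 6 - Y + (s 6 - s 0) * (fun Y => (Y - s 1) * (Y - s 2) * (Y - s 7)) Y
            / (fun Y => (Y + s 6) * ((s 1 + s 2 + s 7 - Y) * (s 0 - Y)) - (Y - s 1) * (Y - s 2) * (Y - s 7)) Y)
          (Y + s 6) k ≠ 0}
      ⊆ {Y | (fun Y => -((Y + s 3) * (Y + s 4) * (Y + s 6) * (Y + s 5)) * (s 1 + s 2 + s 7 - Y) ^ 2 * (s 0 - Y)
      + (2 * Y ^ 3 - 2 * (s 0 - (s 3 + s 4 + s 6 + s 5)) * Y ^ 2 - (s 0 * (s 3 + s 4 + s 6 + s 5)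
          - (s 3 * s 4 + s 3 * s 6 + s 3 * s 5 + s 4 * s 6 + s 4 * s 5 + s 6 * s 5)) * Y
          - (s 0 * (s 3 * s 4 + s 3 * s 6 + s 3 * s 5 + s 4 * s 6 + s 4 * s 5 + s 6 * s 5)
            - (s 3 * s 4 * s 6 + s 3 * s 4 * s 5 + s 3 * s 6 * s 5 + s 4 * s 6 * s 5)))
        * (s 1 + s 2 + s 7 - Y) * ((Y - s 1) * (Y - s 2) * (Y - s 7))
      + (Y - s 0 + (s 3 + s 4 + s 6 + s 5)) * ((Y - s 1) * (Y - s 2) * (Y - s 7)) ^ 2) Y = 0} :=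
    fun Y hY => hY.1
  have hfin' := hfin.subset hsub
  rw [himg]
  refine ⟨hfin'.image _, ?_⟩
  calc _ ≤ _ := Set.ncard_image_le hfin'
    _ ≤ _ := Set.ncard_le_ncard hsub hfin
    _ ≤ 3 := hcard

/-- **At most three critical values at EVERY direction of the open box** (`a = aOfS (sParam a)`): `critVals a` is
finite with `ncard ≤ 3`. Hence `Regular a` (exactly three) is the GENERIC MAXIMUM, and every other open-box
direction has `0`, `1` or `2` critical values (complex roots of the cubic, or roots lost on the loss loci). -/
theorem critVals_finite_of_openBox {a : Dir} (hopen : ∀ j : Fin 7, 0 < sParam a j.succ ∧ sParam a j.succ < sParam a 0) :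
    (critVals a).Finite ∧ (critVals a).ncard ≤ 3 := by
  have h := critVals_aOfS_finite_of_openBox (s := sParam a) hopen
  rwa [aOfS_sParam] at h

end Summit.KontsevichZagierPeriods.Zeta5Search.Barrier.ConeGamma

end
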